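import Summits.AtomisticToContinuum.HydrodynamicLimit.Theorems.ImplosionDichotomyDiluteSelfConsistencyBoundedFamilies

/-!
# `DiluteSelfConsistency` along every isothermal parallel shear flow (stmt-3091)

Support lemmas for the crux `ImplosionDichotomy.DiluteSelfConsistency` (stmt-AtomisticToContinuum-3091), line `birth`
(rev c2), Case I: the bounded-family principle (`ImplosionDichotomyDiluteSelfConsistencyBoundedFamilies.lean`) applied to
the whole infinite-dimensional family of ISOTHERMAL PARALLEL SHEAR PROFILES `(a₀, θ₀, u₀) = (c, ϑ, U)`, `c, ϑ > 0`
constants and `U` any smooth velocity field depending on the coordinate `x₁` only and orthogonal to `e₁`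
(`U x 1 = 0`): the pinned density is `≡ 1` (`rhoLim_const_eq_one`), `(1, U, ϑ)` is a stationary classical
hard-sphere-Euler solution for every `σ` and `T` (`isHardSphereEulerSolution_parallelShear`: every field depends on `x₁`
only, transport is orthogonal to `e₁`, the pressure is constant), hence a σ-uniformly bounded global family, and every
classical solution with these data IS the shear flow (`unique_of_dilute_eos`), of packing `σ³`.

* `isHardSphereEulerSolution_parallelShear` — generalises `HydroLimitInBandNegative.isHardSphereEulerSolution_shear`
  (`U = sin(2π x₁) e₀`, `ϑ = 1`) to arbitrary smooth parallel shear profiles and temperatures.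
* `diluteSelfConsistencyHoldsAt_parallelShear` (registered sub-goal) — the crux's inner clause at every such profile
  and every level `η > 0`.

prover-line-stmt-AtomisticToContinuum-3091-c2-0 (line `birth`, rev c2).
-/

noncomputable section

namespace Summit.AtomisticToContinuum.HydrodynamicLimit.Theorems

open MeasureTheory Filter Set Topology
open Literature.MathematicalPhysics.KineticTheory Literature.Analysis.FluidPDE
open Literature.Analysis.FunctionSpaces
open scoped ContDiff

namespace DiluteSelfConsistencyShearFamily

open PolynomialCompressionPDE (admissible_iff_data)
open PolynomialCompressionConstantProfiles (rhoLim_const_eq_one)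
open HydroLimitInBandNegative (partialDeriv_eq_zero_of_dep)

variable {U : T3 → V3}

/-- A field depending on the coordinate `1` only factors through the axis `c ↦ (0, c, 0)`:
`U y = U (update 0 1 (y 1))`. [folklore] -/
theorem eq_axis (hdep : ∀ x y : T3, x 1 = y 1 → U x = U y) (y : T3) : U y = U (Function.update 0 1 (y 1)) :=
  hdep y (Function.update 0 1 (y 1)) (by simp)

/-- A smooth time-independent field is jointly smooth in space–time. [folklore] -/
theorem isSmoothSpaceTimeOn_static (hU : Torus.IsSmooth U) (S : Set ℝ) :
    Torus.IsSmoothSpaceTimeOn S (fun (_ : ℝ) (x : T3) => U x) := by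
  unfold Torus.IsSmoothSpaceTimeOn
  have h : Torus.stLift (fun (_ : ℝ) (x : T3) => U x) = Torus.lift U ∘ Prod.snd := by
    funext p; simp [Torus.stLift, Torus.lift]
  rw [h]
  exact (hU.comp contDiff_snd).contDiffOn

/-- **Every isothermal parallel shear flow is a classical solution**, for every `σ`, `T` and temperature `ϑ > 0`:
`ρ ≡ 1`, `θ ≡ ϑ`, `u = U` with `U` smooth, depending on `x₁` only and orthogonal to `e₁`. All fields depend on `x₁` only
and the transport is orthogonal to `e₁`, so every term of the three balance laws vanishes; the pressure `ϑ Z(σ³)` is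
constant. [folklore] -/
theorem isHardSphereEulerSolution_parallelShear (hU : Torus.IsSmooth U) (hdep : ∀ x y : T3, x 1 = y 1 → U x = U y)
    (h1 : ∀ x, U x 1 = 0) (σ T : ℝ) {ϑ : ℝ} (hϑ : 0 < ϑ) :
    IsHardSphereEulerSolution σ T (fun _ _ => 1) (fun _ x => U x) (fun _ _ => ϑ) where
  smooth_density := contDiffOn_const
  smooth_velocity := isSmoothSpaceTimeOn_static hU _
  smooth_temperature := contDiffOn_const
  density_pos _ _ _ := one_pos
  temperature_pos _ _ _ := hϑ
  mass t _ x := by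
    have h0 : Torus.timeDerivWithin (Ico 0 T) (fun (_ : ℝ) (_ : T3) => (1 : ℝ)) t x = 0 := by
      simp [Torus.timeDerivWithin]
    rw [h0, zero_add, Torus.divergence]
    refine Finset.sum_eq_zero fun i _ => ?_
    by_cases hi : i = 1
    · subst hi
      have e : (fun y : T3 => ((1 : ℝ) • U y) 1) = fun _ => (0 : ℝ) := by
        funext y; simp [h1 y]
      rw [e]
      simp [Torus.partialDeriv, Torus.lineDeriv]
    · have e : (fun y : T3 => ((1 : ℝ) • U y) i) = fun y => (U (Function.update 0 1 (y 1))) i := by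
        funext y; rw [one_smul, eq_axis hdep y]
      rw [e]
      exact partialDeriv_eq_zero_of_dep (fun c => (U (Function.update 0 1 c)) i) hi x
  momentum t _ x := by
    have h0 : Torus.timeDerivWithin (Ico 0 T) (fun (_ : ℝ) (y : T3) => (1 : ℝ) • U y) t x = 0 := by
      simp [Torus.timeDerivWithin]
    have hp : Torus.gradient (fun _ : T3 => hsPressure σ 1 ϑ) x = 0 := by
      unfold Torus.gradient Torus.liftAt
      exact gradient_fun_const 0 _
    rw [h0, zero_add, hp, add_zero]
    refine Finset.sum_eq_zero fun i _ => ?_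
    by_cases hi : i = 1
    · subst hi
      have e : (fun y : T3 => ((1 : ℝ) * U y 1) • U y) = fun _ => (0 : V3) := by
        funext y; simp [h1 y]
      rw [e]
      simp [Torus.partialDeriv, Torus.lineDeriv]
    · have e : (fun y : T3 => ((1 : ℝ) * U y i) • U y) = fun y => ((U (Function.update 0 1 (y 1))) i) • U (Function.update 0 1 (y 1)) := by
        funext y; rw [one_mul, eq_axis hdep y]
      rw [e]
      exact partialDeriv_eq_zero_of_dep (fun c => ((U (Function.update 0 1 c)) i) • U (Function.update 0 1 c)) hi x
  energy t _ x := by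
    have h0 : Torus.timeDerivWithin (Ico 0 T)
        (fun (_ : ℝ) (y : T3) => totalEnergyDensity 1 (U y) ϑ) t x = 0 := by
      simp [Torus.timeDerivWithin]
    rw [h0, zero_add, Torus.divergence]
    refine Finset.sum_eq_zero fun i _ => ?_
    by_cases hi : i = 1
    · subst hi
      have e : (fun y : T3 => ((totalEnergyDensity 1 (U y) ϑ + hsPressure σ 1 ϑ) • U y) 1) = fun _ => (0 : ℝ) := by
        funext y; simp [h1 y]
      rw [e]
      simp [Torus.partialDeriv, Torus.lineDeriv]
    · have e : (fun y : T3 => ((totalEnergyDensity 1 (U y) ϑ + hsPressure σ 1 ϑ) • U y) i) =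
          fun y => (totalEnergyDensity 1 (U (Function.update 0 1 (y 1))) ϑ + hsPressure σ 1 ϑ) *
            (U (Function.update 0 1 (y 1))) i := by
        funext y; rw [eq_axis hdep y]; simp
      rw [e]
      exact partialDeriv_eq_zero_of_dep
        (fun c => (totalEnergyDensity 1 (U (Function.update 0 1 c)) ϑ + hsPressure σ 1 ϑ) *
          (U (Function.update 0 1 c)) i) hi x

/-- **Every isothermal parallel shear flow is a σ-uniformly bounded global family for its own pinned data**: for the
profiles `(c, ϑ, U)` and every `σ` below the statics threshold, on every horizon the stationary shear flow `(1, U, ϑ)` is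
a classical solution with the pinned data (`rhoLim (profileOf c) σ ≡ 1`) and density `≤ 1`. [folklore] -/
theorem parallelShear_boundedGlobalFamily (hU : Torus.IsSmooth U) (hdep : ∀ x y : T3, x 1 = y 1 → U x = U y)
    (h1 : ∀ x, U x 1 = 0) {c ϑ : ℝ} (hc : 0 < c) (hϑ : 0 < ϑ) :
    ∃ σ₁ : ℝ, 0 < σ₁ ∧ ∀ σ : ℝ, 0 < σ → σ < σ₁ → ∀ T : ℝ, ∃ (ρ₁ θ₁ : ℝ → T3 → ℝ) (u₁ : ℝ → T3 → V3),
      IsHardSphereEulerSolution σ T ρ₁ u₁ θ₁ ∧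
        ρ₁ 0 = rhoLim (profileOf (fun _ : T3 => c) continuous_const fun _ => hc) σ ∧
        u₁ 0 = U ∧ θ₁ 0 = (fun _ => ϑ) ∧ ∀ t ∈ Ico 0 T, ∀ x, ρ₁ t x ≤ 1 := by
  obtain ⟨σ₁, hσ₁, -, G⟩ := admissible_iff_data (a₀ := fun _ : T3 => c) (θ₀ := fun _ => ϑ) (u₀ := U)
    continuous_const continuous_const hU.continuous (fun _ => hc) (fun _ => hϑ)
  refine ⟨σ₁, hσ₁, fun σ hσ hσlt T => ⟨fun _ _ => 1, fun _ _ => ϑ, fun _ x => U x,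
    isHardSphereEulerSolution_parallelShear hU hdep h1 σ T hϑ, ?_, rfl, rfl, fun _ _ _ => le_rfl⟩⟩
  obtain ⟨hS, -⟩ := G σ hσ hσlt
  funext y
  exact (rhoLim_const_eq_one hc hS y).symm

end DiluteSelfConsistencyShearFamily

/-- **`DiluteSelfConsistency` HOLDS AT EVERY ISOTHERMAL PARALLEL SHEAR PROFILE.** For every smooth velocity field `U` on
`𝕋³` depending on the coordinate `x₁` only and orthogonal to `e₁`, all constants `c, ϑ > 0` and every level `η > 0`
there is `σ₀ > 0` with `DiluteSelfConsistencyHoldsAt η c ϑ U σ₀`: for `0 < σ < σ₀` every classical hard-sphere-Euler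
solution on `[0, T)` tied at `t = 0` to the local Gibbs laws of `(c, U, ϑ)` keeps packing `ρ_t(x)σ³ < η` — it IS the
stationary shear flow `(1, U, ϑ)` (bounded-family principle + uniqueness in the whole typed class). An
infinite-dimensional family of non-constant profiles at which the crux is a theorem. [folklore] -/
theorem diluteSelfConsistencyHoldsAt_parallelShear :
    ∀ (U : T3 → V3), Torus.IsSmooth U → (∀ x y : T3, x 1 = y 1 → U x = U y) → (∀ x, U x 1 = 0) →
      ∀ (c ϑ : ℝ), 0 < c → 0 < ϑ → ∀ η : ℝ, 0 < η →
        ∃ σ₀ : ℝ, 0 < σ₀ ∧ DiluteSelfConsistencyHoldsAt η (fun _ => c) (fun _ => ϑ) U σ₀ := by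
  intro U hU hdep h1 c ϑ hc hϑ η hη
  obtain ⟨σ₁, hσ₁, hfam⟩ := DiluteSelfConsistencyShearFamily.parallelShear_boundedGlobalFamily hU hdep h1 hc hϑ
  exact DiluteSelfConsistencyBoundedFamilies.holdsAt_of_boundedGlobalFamily continuous_const continuous_const
    hU.continuous (fun _ => hc) (fun _ => hϑ) hσ₁ hfam hη

end Summit.AtomisticToContinuum.HydrodynamicLimit.Theorems

end
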